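import Summits.BirchSwinnertonDyer.BirchSwinnertonDyer.Theorems.AdditiveBranchIMCGordTwoRankOneHeegnerKolyvaginNecessity
import Summits.BirchSwinnertonDyer.BirchSwinnertonDyer.Theorems.RamifiedHeegnerPairL1IntrinsicA
import Summits.BirchSwinnertonDyer.BirchSwinnertonDyer.Theorems.RamifiedHeegnerPairL1IntrinsicB
import Summits.BirchSwinnertonDyer.BirchSwinnertonDyer.Theorems.RamifiedHeegnerPairL1IntrinsicC
import Literature.NumberTheory.EllipticCurves.HeegnerFieldOfDiscriminantProofs
import Literature.NumberTheory.EllipticCurves.HeegnerPointsRationalityProofs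
import Literature.NumberTheory.EllipticCurves.HeegnerPointsClassesProofs
import Literature.NumberTheory.EllipticCurves.BSDHeegnerPoints
import HarnessLib

/-!
# STEP L (adjusted, tower-row shape) at the ten intrinsic rank-one classes — kernel instances of the load-bearing stub of `kolyvagin_split`

Seat `bsd-trib-w-rhp` g9 (TRIBUNAL-W bc5-witness planner) for route `RamifiedHeegnerPair`; helper for the DECIDING crux
`Gss2LowerAtThreeRankOne` (item 26021, `L₁`) filed `--supports` the aside `RamifiedPairLowerBound` (23191). **BSD is not proved; nothing is
booked; 26021 / 23191 / `L₁` stay OPEN.** (The route's cure-(a) bc5 witness, BKNO Thm 1.7 at `1369c1`, is `RamifiedHeegnerPairRung` since g0.)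

## What
The registered line `kolyvagin_split` (v2) of crux 26021 reduces `Gss2LowerAtThreeRankOne` (tower-rows form) to ONE open stub,
`Sig.stub_existsAdjustedStepL_towerRows` = hypothesis `hEx` of §5
`RamifiedPairLowerBound.gssLowerAtThree_rankOne_towerRows_of_exists_adjustedIndexBound`: for every globally minimal `W` with `Addv W 3`,
`SubGss W 3`, `r_an = 1` and `ρ_{W,3ⁿ}` onto for all `n`, the ADJUSTED STEP L datum exists (Heegner field, modular parametrisation, Heegner
point `P ∈ E(K)`, minimal twist model `Wd`, and `2·ord₃[E(K):ℤP] ≤ ord₃#Ш(E/K) + ord₃∏c(E) + ord₃∏c(Wd) + 2·ord₃ c`).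
This file proves
* `existsAdjustedStepLAt_of_sqrtField` — the DOOR: at `K = sqrtField D` (`D < 0`, `D ≡ 1 (mod 8)` squarefree, `(D/ℓ) = 1` at odd `ℓ ∣ N`,
  `3 ∣ N`, Heegner datum `4N ∣ β² − D`) the `∃`-body at `W` follows from LOWER(E) = `MissingLowerBoundAt W 3`, the trivial LOWER of the
  rank-zero twist (`#Ш(Wd)_an` a `3`-adic unit) and `L(E^D,1) ≠ 0`, under the published inputs; no Tamagawa / Manin / image hypothesis
  (two-sided Gross–Zagier budget `adjustedIndexBound_of_missingLowerBoundAt_of_twistLower`, Darmon Thm 3.6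
  `heegnerPointComplex_mem_range_map_holds`, `exists_heegnerDatum`, `exists_modularParametrization`, `satisfiesHeegnerHypothesis_sqrtField`);
* `towerRows_of_forall_existsAdjustedStepLAt` — LINKAGE: the door's conclusion universally in `W` is literally `hEx` (kernel restatement:
  the instances below are instances of THE STUB'S BODY);
* for each of the ten intrinsic classes `E` (`#Ш(E)_an = 9`, trivial torsion part at 3) of the k1 rank-one additive (G) ∧ ss frontier —
  `133956n1, 169848k1, 205128l2, 182853c1, 228897c1, 250065g1, 355338h1, 409248cy1, 439794p1, 205128l1` — `stepL_at_<label>`: the body at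
  `W = E` over `K = ℚ(√D)` with KERNEL side conditions (field, Heegner hypothesis, Heegner datum, Kraus minimality of `Wd`, twist identity
  `Cd • E^D = Wd` with `u = 1`, `3 ∤ #𝓞_K^×`) and DISPLAYED numerics (`hN` conductor, `hr`, `hq/hv` `#Ш(E)_an`, `hSel` the g8 rigorous
  3-descent `27 ∣ #Sel₃(E)`, `hLt`, `hqd/hvd`), plus `row_<label>`: `Addv ∧ SubGss ∧ ρ_{E,3}` onto in the kernel (`subGss_three_<label>`
  is new for `133956n1, 169848k1, 205128l2`; the k1 `Gss2Records` give the rest). `133956n1` (`c₂ = 3`) is the one class where the k1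
  Tamagawa-unit door is shut; the intrinsic door is not.

## Data (kit jobs j304302 = phase 1 of record, j304074 = + exact Heegner indices, j304038 smoke; engines `stepl.py`, `heeg2.gp` = QP1-E1)
Per class: `D` = least fundamental discriminant `≡ 1 (mod 8)`, split at the odd `ℓ ∣ N`, with `L(E^D,1) ≠ 0` (PARI `ellL1` = `lfun`) and
`3 ∤ #Ш(E^D)_an`; `Wd` = minimal model of `E^D` in Mathlib's twist convention (identity re-verified exactly in-script and here in the kernel);
Gross–Zagier instrument `ord₃[E(K):ℤy_K]` from heights, the EXACT multiplier from CM-point evaluation where `N ≤ 260000`, and the BSD-budget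
prediction agree in every row (all three displayed in the docstrings; none is used in a proof). Tower levels `n ≥ 2` (`ρ_{E,9}` onto, hence
`ρ_{E,3ⁿ}` onto by Serre IV-23 Lemma 3 + Exerc. 3 for p = 3): exact subgroup enumeration in `GL₂(ℤ/9)` + Frobenius witnesses, Lines card `stepl_intrinsic.md` of 23191 —
card level, not typed (the tree's mod-3 → 3ⁿ lifting exists only for good ordinary / multiplicative reduction at 3).
[cite: JetchevSkinnerWan2017, §7.4.1 (pp. 29–31)] [cite: GrossZagier1986, Thm. I.(6.3), V.§2] [cite: Darmon2004, Thm. 3.6]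
[cite: SchaeferStoll2004, Cor. 5.9] [cite: Serre1972, IV-23 Lemme 3] [cite: Cremona2006, Table 1] [cite: SilvermanAEC2009, VII.1, VII.5]
-/

set_option autoImplicit false

noncomputable section

open scoped Classical NumberField

open WeierstrassCurve NumberField IsDedekindDomain IsDedekindDomain.HeightOneSpectrum Rat.HeightOneSpectrum Field
  Literature.NumberTheory.DiophantineGeometry Literature.NumberTheory.EllipticCurves
  Literature.NumberTheory.EllipticCurves.ModularForms Literature.NumberTheory.EllipticCurves.Rank1Residual
  Literature.NumberTheory.EllipticCurves.Rank1Residual.Typed Literature.NumberTheory.Automorphic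
  Literature.NumberTheory.EllipticCurves.Rank1Residual.X11RankOneCertificates
  Literature.NumberTheory.GaloisRepresentations Literature.NumberTheory.QuadraticFields
  Summit.BirchSwinnertonDyer.BirchSwinnertonDyer.Rank1Residual.IntModel
  Summit.BirchSwinnertonDyer.Rank1Residual Summit.BirchSwinnertonDyer.Rank1Residual.Additive
  Summit.BirchSwinnertonDyer.Rank1Residual.X11b Summit.BirchSwinnertonDyer.Rank1Residual.GaloisImage
  Summit.BirchSwinnertonDyer.Rank1Residual.Supersingular
  Summit.BirchSwinnertonDyer.BirchSwinnertonDyer.Theses.AdditiveKolyvaginRoad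
  Summit.BirchSwinnertonDyer.BirchSwinnertonDyer.Theorems.AdditiveKolyvaginKernel
  Summit.BirchSwinnertonDyer.BirchSwinnertonDyer.Theorems
  Summit.BirchSwinnertonDyer.BirchSwinnertonDyer.Theorems.AdditiveBranchIMCGordTwoRankOne.HeegnerKolyvagin

namespace Summit.BirchSwinnertonDyer.BirchSwinnertonDyer.Theorems.RamifiedHeegnerPairStepLIntrinsic

/-- **The generic door: STEP L at a certified split Heegner field `ℚ(√D)`.** Data: an explicit level `N` with `3 ∣ N`,
a negative squarefree `D ≡ 1 (mod 8)` with `(D/ℓ) = 1` for every odd prime `ℓ ∣ N` (so every `ℓ ∣ N` splits in `K = ℚ(√D)`,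
`d_K = D`), an explicit `β` with `4N ∣ β² − D` (Heegner datum), an explicit globally minimal model `Wd` of `E^{(D)}` with
change `Cd` a `3`-unit. PUBLISHED binders: `hmodP` (modular parametrisation, BCDT), `hN` (the conductor value), `hGZ`, `hKo`,
`hGZK`, `hmod`. INPUT: `hr` (`r_an = 1`), the twist value `L(E^{(D)},1) ≠ 0`, the LOWER half `MissingLowerBoundAt W 3`
(here: the 3-descent certificate of the L1Intrinsic records) and the LOWER half of the rank-zero twist in its trivial form
`Ш_an(Wd) = qd` with `ord₃ qd ≤ 0`. OUTPUT: the `∃`-body of the adjusted STEP L at `W`, via NO FREE LUNCH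
(`adjustedIndexBound_of_missingLowerBoundAt_of_twistLower`). No Tamagawa, Manin or image hypothesis.
[cite: JetchevSkinnerWan2017, §7.4.1 (pp. 29–31)] [cite: GrossZagier1986, V.§2 and Conj. (V.2.2)] [cite: GrossLMS1991, §1]
[cite: Cox2013, §5.B] -/
theorem existsAdjustedStepLAt_of_sqrtField (W : WeierstrassCurve ℚ) [W.IsElliptic] [W.IsGloballyMinimal]
    (N : ℕ) [NeZero N] (D : ℤ) [hD : Fact (D < 0)] (hD8 : D % 8 = 1) (hsfN : Squarefree D.natAbs)
    (hjac : ∀ ℓ : ℕ, ℓ.Prime → ℓ ∣ N → ℓ ≠ 2 → jacobiSym D ℓ = 1)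
    (β : ℤ) (hβ : (4 * N : ℤ) ∣ β ^ 2 - D) (h3N : 3 ∣ N)
    (hmodP : nonempty_modularParametrizationData) (hN : W.conductorNorm ℤ = N)
    (hGZ : ∀ (N : ℕ) [NeZero N] (W : WeierstrassCurve ℚ) (K : Type) [Field K] [NumberField K], gross_zagier N W K)
    (hKo : ∀ (N : ℕ) [NeZero N] (W : WeierstrassCurve ℚ) (K : Type) [Field K] [NumberField K], kolyvagin N W K)
    (hGZK : rank_eq_analyticRank_of_analyticRank_le_one) (hmod : hasEntireLFunction_rat)
    (hr : W.analyticRank = 1) (hLt : (W.quadraticTwist (D : ℚ)).entireLFunction 1 ≠ 0)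
    (hlow : MissingLowerBoundAt W 3)
    (Wd : WeierstrassCurve ℚ) [Wd.IsElliptic] [Wd.IsGloballyMinimal] (Cd : VariableChange ℚ)
    (hWd : Cd • W.quadraticTwist (D : ℚ) = Wd) (hu : padicValRat 3 (Cd.u : ℚ) = 0)
    {qd : ℚ} (hqd : shaAn Wd = (qd : ℂ)) (hvd : padicValRat 3 qd ≤ 0) :
    ∃ (N : ℕ) (_ : NeZero N) (K : Type) (_ : Field K) (_ : NumberField K)
      (Dt : ModularParametrizationData W N) (H : HeegnerDatum N (NumberField.discr K)) (ι : K →+* ℂ)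
      (P : (W.baseChange K).toAffine.Point)
      (Wd : WeierstrassCurve ℚ) (_ : Wd.IsElliptic) (_ : Wd.IsGloballyMinimal) (Cd : VariableChange ℚ),
      W.conductorNorm ℤ = N ∧ IsImaginaryQuadratic K ∧ SatisfiesHeegnerHypothesis N K ∧
      (W.quadraticTwist (NumberField.discr K : ℚ)).entireLFunction 1 ≠ 0 ∧
      WeierstrassCurve.Affine.Point.map ι.toRatAlgHom P = heegnerPointComplex Dt H ∧
      Cd • W.quadraticTwist (NumberField.discr K : ℚ) = Wd ∧
      (Finite (W.baseChange K).sha →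
        (2 * padicValNat 3 (AddSubgroup.zmultiples P).index : ℤ) ≤
          padicValNat 3 (W.baseChange K).shaOrder + padicValNat 3 W.tamagawaProduct +
            padicValNat 3 Wd.tamagawaProduct + 2 * padicValRat 3 (Dt.c : ℚ)) := by
  haveI : Fact (Nat.Prime 3) := ⟨by norm_num⟩
  have hsf : Squarefree D := Int.squarefree_natAbs.mp hsfN
  obtain ⟨hK, hdisc⟩ := isImaginaryQuadratic_and_discr_sqrtField D (by omega) hsf
  have hHN : SatisfiesHeegnerHypothesis N (sqrtField D) := satisfiesHeegnerHypothesis_sqrtField D hD8 hsf hjac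
  obtain ⟨H, -⟩ := exists_heegnerDatum N (D := NumberField.discr (sqrtField D)) (by rw [hdisc]; exact hD.out)
    (β := β) (by rw [hdisc]; exact hβ)
  obtain ⟨Dt⟩ := exists_modularParametrization W N hmodP hN
  obtain ⟨ι⟩ : Nonempty (sqrtField D →+* ℂ) := inferInstance
  obtain ⟨P, hP⟩ := (heegnerPointComplex_mem_range_map_holds N W (sqrtField D)) hK hHN Dt H ι
  have hμ : ¬ 3 ∣ Units.torsionOrder (sqrtField D) :=
    (X11b.Three.not_dvd_discr_and_not_dvd_torsionOrder_of_heegner hK hHN (by decide) h3N).2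
  have hLt' : (W.quadraticTwist (NumberField.discr (sqrtField D) : ℚ)).entireLFunction 1 ≠ 0 := by rw [hdisc]; exact hLt
  have hWd' : Cd • W.quadraticTwist (NumberField.discr (sqrtField D) : ℚ) = Wd := by rw [hdisc]; exact hWd
  have htwL : MissingLowerBoundAt Wd 3 := ⟨qd, hqd, hvd.trans (by exact_mod_cast Nat.zero_le _)⟩
  refine ⟨N, inferInstance, sqrtField D, inferInstance, inferInstance, Dt, H, ι, P, Wd, inferInstance, inferInstance, Cd,
    hN, hK, hHN, hLt', hP, hWd', fun _ => ?_⟩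
  exact adjustedIndexBound_of_missingLowerBoundAt_of_twistLower W 3 N (sqrtField D) Dt H ι P (hGZ _ W _) (hKo _ W _)
    hGZK hmod hK hHN hP (by decide) hμ hr hLt' Wd Cd hWd' hu hlow htwL


/-! ## `133956n1` = `[0, 0, 0, 33489, -36770922]`, `N = 133956 = 2^2·3^2·61^2`, `K = ℚ(√-47)`, `Wd = [0, 0, 0, 73977201, 3817667434806]` (`N(Wd) = 295908804`), kit j304074 -/
/-- `[0, 0, 0, 73977201, 3817667434806]` (the minimal model `Wd` of the twist `133956n1^{(-47)}`, change `[u,r,s,t] = [1, 0, 0, 0]` from the tree model, conductor `295908804`) is an elliptic curve: `|Δ| = 2⁸·3⁶·47⁶·61⁷ ≠ 0`. [cite: Cremona2006, Table 1 (Cremona label 133956n1)] -/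
theorem isElliptic_sWd133956n1 : (⟨0, 0, 0, 73977201, 3817667434806⟩ : WeierstrassCurve ℚ).IsElliptic :=
  isElliptic_of_discOf_ne_zero 0 0 0 73977201 3817667434806 (by decide +kernel)

/-- `[0, 0, 0, 73977201, 3817667434806]` (the minimal model `Wd` of the twist `133956n1^{(-47)}`, change `[u,r,s,t] = [1, 0, 0, 0]` from the tree model, conductor `295908804`) is globally minimal: `|Δ| = 2⁸·3⁶·47⁶·61⁷` kernel-checked, Kraus/Silverman prime by prime.
[cite: SilvermanAEC2009, VII.1 Remark 1.1] [cite: Kraus1989, Prop. 1 and Prop. 2] [cite: Cremona2006, Table 1 (Cremona label 133956n1)] -/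
theorem isGloballyMinimal_sWd133956n1 : (⟨0, 0, 0, 73977201, 3817667434806⟩ : WeierstrassCurve ℚ).IsGloballyMinimal :=
  isGloballyMinimal_of_krausCriterion₃_factored 0 0 0 73977201 3817667434806
    [(2, 8), (3, 6), (47, 6), (61, 7)] (by decide +kernel)
    (by intro qe hqe; simp only [List.mem_cons, List.not_mem_nil, or_false] at hqe
        rcases hqe with rfl | rfl | rfl | rfl <;> norm_num)
    (by set_option synthInstance.maxSize 2000 in decide +kernel)
/-- `[0, 0, 0, 3721, 1361886]` (the minimal model `V` of `133956n1^{(-3)}`, conductor `14884`) is an elliptic curve: `|Δ| = 2⁸·61⁷ ≠ 0`. [cite: Cremona2006, Table 1 (Cremona label 133956n1)] -/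
theorem isElliptic_sV133956n1 : (⟨0, 0, 0, 3721, 1361886⟩ : WeierstrassCurve ℚ).IsElliptic :=
  isElliptic_of_discOf_ne_zero 0 0 0 3721 1361886 (by decide +kernel)

/-- `[0, 0, 0, 3721, 1361886]` (the minimal model `V` of `133956n1^{(-3)}`, conductor `14884`) is globally minimal: `|Δ| = 2⁸·61⁷` kernel-checked, Kraus/Silverman prime by prime.
[cite: SilvermanAEC2009, VII.1 Remark 1.1] [cite: Kraus1989, Prop. 1 and Prop. 2] [cite: Cremona2006, Table 1 (Cremona label 133956n1)] -/
theorem isGloballyMinimal_sV133956n1 : (⟨0, 0, 0, 3721, 1361886⟩ : WeierstrassCurve ℚ).IsGloballyMinimal :=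
  isGloballyMinimal_of_krausCriterion₃_factored 0 0 0 3721 1361886
    [(2, 8), (61, 7)] (by decide +kernel)
    (by intro qe hqe; simp only [List.mem_cons, List.not_mem_nil, or_false] at hqe
        rcases hqe with rfl | rfl <;> norm_num)
    (by set_option synthInstance.maxSize 2000 in decide +kernel)

/-- **`133956n1` is ADDITIVE at `3` and lies on the cell (G) ∧ ss** IN THE KERNEL: `3 ∣ Δ`, `3 ∣ c₄` (`Additive.addv_of_intModel`);
`C • V^{(-3)} = E`, `[u, r, s, t] = [1, 0, 0, 0]`, with `V = [0, 0, 0, 3721, 1361886]` globally minimal, `3 ∤ Δ(V)`, `#Ṽ(𝔽₃) = 4`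
(`a₃(V) = 0`: supersingular), whence `TypeG`, `SubGord`, `SubGss` at `3` exactly as in the k1 records.
[cite: SilvermanAEC2009, VII.5 Prop. 5.1 (a), (c)] [cite: Delbourgo1998, §1.5 (G)] [cite: Cremona2006, Table 1 (Cremona label 133956n1)] -/
theorem subGss_three_133956n1 :
    haveI := RamifiedHeegnerPairL1Intrinsic.isElliptic_133956n1; haveI := RamifiedHeegnerPairL1Intrinsic.isGloballyMinimal_133956n1
    Addv (⟨0, 0, 0, 33489, -36770922⟩ : WeierstrassCurve ℚ) 3 ∧ SubGss (⟨0, 0, 0, 33489, -36770922⟩ : WeierstrassCurve ℚ) 3 := by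
  haveI := RamifiedHeegnerPairL1Intrinsic.isElliptic_133956n1
  haveI := RamifiedHeegnerPairL1Intrinsic.isGloballyMinimal_133956n1
  haveI := isElliptic_sV133956n1
  haveI := isGloballyMinimal_sV133956n1
  have hIW : integralModelInt (⟨0, 0, 0, 33489, -36770922⟩ : WeierstrassCurve ℚ) = (⟨0, 0, 0, 33489, -36770922⟩ : WeierstrassCurve ℤ) :=
    integralModelInt_eq_of_map_eq _ (map_mk_int 0 0 0 33489 (-36770922))
  have hadd : Addv (⟨0, 0, 0, 33489, -36770922⟩ : WeierstrassCurve ℚ) 3 := Additive.addv_of_intModel hIW 3 (by decide +kernel) (by decide +kernel)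
  have hIV : integralModelInt (⟨0, 0, 0, 3721, 1361886⟩ : WeierstrassCurve ℚ) = (⟨0, 0, 0, 3721, 1361886⟩ : WeierstrassCurve ℤ) :=
    integralModelInt_eq_of_map_eq _ (map_mk_int 0 0 0 3721 1361886)
  have hcV : Nat.card (((((⟨0, 0, 0, 3721, 1361886⟩ : WeierstrassCurve ℤ))).map (Int.castRingHom (ZMod 3))).toAffine.Point) = 4 := by
    have h := natCard_point_eq_countPoints 0 0 0 3721 1361886 3 (by norm_num) (by decide +kernel)
    have h' : countPoints [0, 0, 0, 3721, 1361886] 3 = 4 := countPoints_eq_of_fast (by decide +kernel)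
    exact_mod_cast h.trans h'
  have hgood : GoodSS (⟨0, 0, 0, 3721, 1361886⟩ : WeierstrassCurve ℚ) 3 := Supersingular.goodSS_of_intModel 3 hIV (by decide +kernel) hcV (by decide)
  have hVW : (⟨1, (0 : ℚ), (0 : ℚ), (0 : ℚ)⟩ : VariableChange ℚ) • (⟨0, 0, 0, 3721, 1361886⟩ : WeierstrassCurve ℚ).quadraticTwist (-3) = (⟨0, 0, 0, 33489, -36770922⟩ : WeierstrassCurve ℚ) := by
    ext <;> simp [WeierstrassCurve.variableChange_a₁, WeierstrassCurve.variableChange_a₂,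
      WeierstrassCurve.variableChange_a₃, WeierstrassCurve.variableChange_a₄, WeierstrassCurve.variableChange_a₆,
      WeierstrassCurve.quadraticTwist, WeierstrassCurve.b₂, WeierstrassCurve.b₄, WeierstrassCurve.b₆] <;> norm_num
  obtain ⟨C, hC⟩ := exists_variableChange_quadraticTwist_symm (⟨0, 0, 0, 33489, -36770922⟩ : WeierstrassCurve ℚ) (⟨0, 0, 0, 3721, 1361886⟩ : WeierstrassCurve ℚ) (d := (-3 : ℚ)) (by norm_num) ⟨_, hVW⟩
  have hC' : C • (⟨0, 0, 0, 33489, -36770922⟩ : WeierstrassCurve ℚ).quadraticTwist ((-1 : ℚ) ^ ((3 : ℕ) / 2) * (3 : ℕ)) = (⟨0, 0, 0, 3721, 1361886⟩ : WeierstrassCurve ℚ) := by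
    rw [O5.pstar_three]; exact hC
  have hG : TypeG (⟨0, 0, 0, 33489, -36770922⟩ : WeierstrassCurve ℚ) 3 := (typeG_three_iff_good_twist _ hadd _ C hC').mpr hgood.1
  exact ⟨hadd, (O5.subGss_three_iff_subGord_and_goodSS_twist _ hadd _ C hC).mpr
    ⟨subGord_three_of_typeG_of_addv _ hG hadd, hgood⟩⟩

/-- **Row membership of `133956n1`, kernel part**: additive (G) ∧ ss at `3` and `ρ_{E,3}` onto (`n = 1` of the tower). The levels
`n ≥ 2`: `ρ_{E,9}` is onto — Frobenius witness `(a_ℓ, ℓ) mod 9 = (3, 5)` at `ℓ = 5`, outside the `(tr, det)`-profile of the 27 index-27 subgroups AND of the index-3 subgroup, these being ALL maximal mod-3-surjective proper subgroups of `GL₂(ℤ/9)`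
(exact enumeration, Lines card `stepl_intrinsic.md` of item 23191) — whence `ρ_{E,3^n}` onto for all `n` by Serre's lifting lemma; not typed here.
[cite: Serre1972, IV-23 Lemma 3 with its Exercise 3 (p = 3: surjectivity mod 9 suffices)] [cite: Cremona2006, Table 1 (Cremona label 133956n1)] -/
theorem row_133956n1 :
    haveI := RamifiedHeegnerPairL1Intrinsic.isElliptic_133956n1; haveI := RamifiedHeegnerPairL1Intrinsic.isGloballyMinimal_133956n1
    Addv (⟨0, 0, 0, 33489, -36770922⟩ : WeierstrassCurve ℚ) 3 ∧ SubGss (⟨0, 0, 0, 33489, -36770922⟩ : WeierstrassCurve ℚ) 3 ∧ (⟨0, 0, 0, 33489, -36770922⟩ : WeierstrassCurve ℚ).HasSurjectiveModNGaloisRep (3 ^ 1 : ℕ) := by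
  have h : (⟨0, 0, 0, 33489, -36770922⟩ : WeierstrassCurve ℚ).HasSurjectiveModNGaloisRep ((3 : ℕ) : ℤ) := RamifiedHeegnerPairL1Intrinsic.surj_three_133956n1
  exact ⟨subGss_three_133956n1.1, subGss_three_133956n1.2, by simpa using h⟩

/-- **STEP L (adjusted, tower-row shape) AT `133956n1` over `K = ℚ(√-47)`** — an instance of the `∃`-body of
`Sig.stub_existsAdjustedStepL_towerRows` (= `hEx` of §5) at an INTRINSIC class (`#Ш(E)_an = 9`). KERNEL: `K = sqrtField (-47)` (imaginary
quadratic, `d_K = -47`), the Heegner hypothesis at `N = 133956` (`-47 ≡ 1 (mod 8)`, `(-47/ℓ) = 1` at the odd `ℓ ∣ N`), the Heegner datum `β = 7097`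
(`4N ∣ β² − (-47)`), minimality of `Wd = [0, 0, 0, 73977201, 3817667434806]` (`Kraus, above`), the twist identity `Cd • E^{(-47)} = Wd`,
`[u,r,s,t] = [1, 0, 0, 0]` (`3`-unit), `3 ∤ #𝓞_K^×`; `P ∈ E(K)` over the complex Heegner point is Darmon Thm 3.6 (tree theorem
`heegnerPointComplex_mem_range_map_holds`). PUBLISHED binders: `hmodP` (BCDT), `hGZ`, `hKo`, `hGZK`, `hmod`. DISPLAYED numerics: Cremona's
`N(E) = 133956` (`hN`), `r_an(E) = 1` (`hr`), `#Ш(E)_an = q`, `ord₃ q ≤ 2` (`hq`/`hv`), the rigorous 3-descent certificate `27 ∣ #Sel₃(E)` (`hSel`,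
L1Intrinsic records), `L(E^{(-47)},1) = 1.5645411526 ≠ 0` (`hLt`; PARI `ellL1` = `lfun`, agree True), `#Ш(Wd)_an = 1` (`hqd`/`hvd`;
`N(Wd) = 295908804`, `∏c(Wd) = 48`, `#Wd(ℚ)_tors = 1`). INSTRUMENT (not used in the proof): Gross–Zagier heights give `[E(K):ℤy_K]² /4 = ρ = ĥ(y_K)/ĥ(P_gen) = 5184.0`, `m = 144` (`ord₃ m = 2`; float error 0.0e+00); the EXACT engine (CM-point evaluation of the modular parametrisation, QP1-E1 `heeg2.gp`, 35 s) finds `2y_K = n·P_gen + T` with `n ∈ {144}`, `ord₃ n = 2`; BSD-budget prediction `ord₃ m = (ord₃#Ш(E)_an + ord₃#Ш(Wd)_an + ord₃∏c(E) + ord₃∏c(Wd))/2 = (2+0+1+1)/2 = 2`.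
Nothing is booked; L₁ / items 26021, 23191 stay OPEN; BSD is not proved by this.
[cite: JetchevSkinnerWan2017, §7.4.1 (pp. 29–31)] [cite: GrossZagier1986, Thm. I.(6.3), V.§2] [cite: Darmon2004, Thm. 3.6]
[cite: SchaeferStoll2004, Cor. 5.9] [cite: Marcus2018, Ch. 3 Thm. 25] [cite: Cremona2006, Table 1 (Cremona label 133956n1)] -/
theorem stepL_at_133956n1
    (hmodP : nonempty_modularParametrizationData)
    (hGZ : ∀ (N : ℕ) [NeZero N] (W : WeierstrassCurve ℚ) (K : Type) [Field K] [NumberField K], gross_zagier N W K)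
    (hKo : ∀ (N : ℕ) [NeZero N] (W : WeierstrassCurve ℚ) (K : Type) [Field K] [NumberField K], kolyvagin N W K)
    (hGZK : rank_eq_analyticRank_of_analyticRank_le_one) (hmod : hasEntireLFunction_rat)
    {W : WeierstrassCurve ℚ} [W.IsElliptic] [W.IsGloballyMinimal] (hWeq : W = (⟨0, 0, 0, 33489, -36770922⟩ : WeierstrassCurve ℚ))
    (hN : W.conductorNorm ℤ = 133956) (hr : W.analyticRank = 1)
    {q : ℚ} (hq : shaAn W = (q : ℂ)) (hv : padicValRat 3 q ≤ 2) (hSel : 3 ^ 3 ∣ Nat.card (W.selmerGroup 3))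
    (hLt : (W.quadraticTwist ((-47 : ℤ) : ℚ)).entireLFunction 1 ≠ 0)
    {qd : ℚ} (hqd : haveI := isElliptic_sWd133956n1; shaAn (⟨0, 0, 0, 73977201, 3817667434806⟩ : WeierstrassCurve ℚ) = (qd : ℂ)) (hvd : padicValRat 3 qd ≤ 0) :
    ∃ (N : ℕ) (_ : NeZero N) (K : Type) (_ : Field K) (_ : NumberField K)
      (Dt : ModularParametrizationData W N) (H : HeegnerDatum N (NumberField.discr K)) (ι : K →+* ℂ)
      (P : (W.baseChange K).toAffine.Point)
      (Wd : WeierstrassCurve ℚ) (_ : Wd.IsElliptic) (_ : Wd.IsGloballyMinimal) (Cd : VariableChange ℚ),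
      W.conductorNorm ℤ = N ∧ IsImaginaryQuadratic K ∧ SatisfiesHeegnerHypothesis N K ∧
      (W.quadraticTwist (NumberField.discr K : ℚ)).entireLFunction 1 ≠ 0 ∧
      WeierstrassCurve.Affine.Point.map ι.toRatAlgHom P = heegnerPointComplex Dt H ∧
      Cd • W.quadraticTwist (NumberField.discr K : ℚ) = Wd ∧
      (Finite (W.baseChange K).sha →
        (2 * padicValNat 3 (AddSubgroup.zmultiples P).index : ℤ) ≤
          padicValNat 3 (W.baseChange K).shaOrder + padicValNat 3 W.tamagawaProduct +
            padicValNat 3 Wd.tamagawaProduct + 2 * padicValRat 3 (Dt.c : ℚ)) := by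
  subst hWeq
  haveI := isElliptic_sWd133956n1; haveI := isGloballyMinimal_sWd133956n1
  haveI : Fact ((-47 : ℤ) < 0) := ⟨by norm_num⟩
  haveI : NeZero (133956 : ℕ) := ⟨by norm_num⟩
  have hlow : MissingLowerBoundAt (⟨0, 0, 0, 33489, -36770922⟩ : WeierstrassCurve ℚ) 3 :=
    RamifiedHeegnerPairL1Intrinsic.lowerHalf_three_133956n1 hGZK hr hq hv hSel
  have hjac : ∀ ℓ : ℕ, ℓ.Prime → ℓ ∣ 133956 → ℓ ≠ 2 → jacobiSym (-47) ℓ = 1 := by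
    intro ℓ hℓ hℓN hℓ2
    have hmem : ℓ ∈ Nat.primeFactors 133956 := Nat.mem_primeFactors.mpr ⟨hℓ, hℓN, by norm_num⟩
    have hpf : Nat.primeFactors 133956 = {2, 3, 61} := by decide +kernel
    rw [hpf] at hmem
    simp only [Finset.mem_insert, Finset.mem_singleton] at hmem
    rcases hmem with rfl | rfl | rfl
    · exact absurd rfl hℓ2
    all_goals norm_num
  have hWd : (⟨1, (0 : ℚ), (0 : ℚ), (0 : ℚ)⟩ : VariableChange ℚ) •
      (⟨0, 0, 0, 33489, -36770922⟩ : WeierstrassCurve ℚ).quadraticTwist ((-47 : ℤ) : ℚ) = (⟨0, 0, 0, 73977201, 3817667434806⟩ : WeierstrassCurve ℚ) := by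
    push_cast
    ext <;> simp [WeierstrassCurve.variableChange_a₁, WeierstrassCurve.variableChange_a₂,
      WeierstrassCurve.variableChange_a₃, WeierstrassCurve.variableChange_a₄, WeierstrassCurve.variableChange_a₆,
      WeierstrassCurve.quadraticTwist, WeierstrassCurve.b₂, WeierstrassCurve.b₄, WeierstrassCurve.b₆] <;> norm_num
  exact existsAdjustedStepLAt_of_sqrtField _ 133956 (-47) (by norm_num)
    (by rw [show (-47 : ℤ).natAbs = 47 by rfl, Nat.squarefree_iff_nodup_primeFactorsList (by norm_num)]; simp)
    hjac 7097 (by norm_num) (by norm_num) hmodP hN hGZ hKo hGZK hmod hr hLt hlow _ _ hWd (by simp) hqd hvd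

end Summit.BirchSwinnertonDyer.BirchSwinnertonDyer.Theorems.RamifiedHeegnerPairStepLIntrinsic

end
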